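import Summits.QuantumFields.YangMills.Theorems.UnitScaleTiltProp7CornerCombLoopDefects
import Literature.MathematicalPhysics.QuantumFieldTheory.Balaban1983to89.B7Eq47AveragedBondVsStraight
import Mathlib.Algebra.Order.Chebyshev
import HarnessLib

/-!
# (n3)-COMB (II) «COMB = STRAIGHT ∘ BLOCK-AXIAL», file F-6c-3b: THE TOP PAIR — the comb-transported block means of ONE field over two ADJACENT blocks `B(q)`, `B(q + L•e_κ)`,
# compared through the averaged bond `V̄(q, κ)`: `‖X̄^{cov}(q) − Ad_{V̄(q,κ)} X̄^{cov}(q + Le_κ)‖² ≤ 2L^{1−d}·(covariant κ-gradient energy on the double block) + (loop ∕ averaging defects)²·(mass)`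
# (organisation β of ★routeR-w1 g9's PENS ROUND 3 (iv), the pair that joins the two scale chains of F-6c-3a at the common top scale)

Crux `stmt-QuantumFields-19200` `MinimiserStabilityRegPr`, route-R E′ (A′)-on-Σ, package P-A2, row (β); the DISPLAYED route-internal row `hMcomb` («(n3)-comb», SIGNATURE-0,
★★OWNER RULINGS №19 O4 ∕ №22; OPEN, XL) and its supplier design (II) (MASTER `DESIGN-N3COMB-LINEAR-CORE` 6efb31c3 §1 rows 7–8, §5 F-6c; PENS ROUND 3 2026-08-29T08:01:48Z (iv):
«the TOP PAIR `[m⁽ᵏ⁻¹⁾(z) − Ad_{Ūᵏ(z,κ)} m⁽ᵏ⁻¹⁾(z + e_κ)]·(Lᵏ−1)∕2` (adjacent level-(k−1) blocks)»).  Seat `ym-ust-19200-w3` g13 (pen «F-6c-3»); `--kind proof --supports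
stmt-QuantumFields-19200 --as helper`; THEOREMS ONLY (0 `def`, 0 `sorry`); «(O2) groundwork — not consumed by any displayed row before the freeze lifts»; count-neutral.
YM₃ on T³ is a ladder rung (R3), NOT d = 4, NOT infinite volume, NOT the Clay problem; nothing here is progress on the YM mass gap; nothing of `hMcomb` ∕ `hMcomb₂` ∕ (β) ∕ `hD` ∕ the stub ∕
the crux is proved or claimed.

## The mechanism (no Poincaré: exact telescoping + two re-basing defects)
For `x = q + s` in the block and `x′ = x + L•e_κ` in the neighbouring block, the transported value `Ad_{V(Γ_{q,x})}X(x)` at the corner `q` and the doubly transported neighbour value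
`Ad_{V̄(q,κ)}Ad_{V(Γ_{q′,x′})}X(x′)` (`q′ = q + L•e_κ`) differ by: (I) EXACTLY `L` transported covariant unit differences along the straight run from `x` to `x′` (★routeR-w4 cov-1
✓`conjR_hol_append_seg_sub_eq_sum`); (II) the re-basing of the transport `Γ_{q,x} ++ [x,x′]` to `[q,q′] ++ Γ_{q′,x′}` — a closed loop of length `≤ 2(d+1)L`, `≤ 8((d+1)L)²·a·‖X(x′)‖` by
cov-1 ✓`norm_conjR_hol_sub_conjR_hol_le`; (III) the averaged bond `V̄(q,κ)` against the straight transporter `V([q,q′])` — `‖V̄ − V([q,q′])‖ ≤ 4w` on the loop window `w ≤ 1∕8` (lit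
✓`B7Eq47AveragedBondVsStraight.norm_bavg_sub_straight_le`), `≤ 8w·‖X(x′)‖` after the `2`-Lipschitz bound `‖Ad_u y − Ad_v y‖ ≤ 2‖u − v‖·‖y‖` on `U1` (= ★w4-20520 g12's ✓`Prop7CornerFrameLegsLetters.norm_conjR_sub_conjR_le`; used here as a LOCAL step of §2's proof, not restated as a declaration, to keep the import closure inside the (II) lane).  Summing over the block with the weight `L⁻ᵈ` and squaring
(Cauchy–Schwarz over the `Lᵈ·L` gradient slots and the `Lᵈ` mass slots) gives ★ `normSq_blockMean_sub_conjR_bavg_blockMean_le`.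

## What is here (any `d`, any `L ≥ 1`; `𝔸` any complete normed `ℂ`-algebra with `‖1‖ = 1`; `V` valued in lit `U1`; constants closed numerals in `(d, L)`)
* §1 `hol_seg_append` (bookkeeping: `V([q,q′] ++ Γ) = V([q,q′])·V(Γ from q′)`).
* §2 ★ `norm_transport_pair_sub_le` — the per-site row (I)+(II)+(III):
  `‖Ad_{V(Γ_{q,q+s})}X(q+s) − Ad_{V̄(q,κ)}Ad_{V(Γ_{q′,q′+s})}X(q′+s)‖ ≤ Σ_{t<L}‖Ad_{V(q+s+te_κ,κ)}X(q+s+(t+1)e_κ) − X(q+s+te_κ)‖ + (8((d+1)L)²a + 8w)·‖X(q′+s)‖`.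
* §3 ★★ `normSq_blockMean_sub_conjR_bavg_blockMean_le` — THE TOP PAIR ROW:
  `‖L⁻ᵈ•Σ_s Ad_{V(Γ_{q,q+s})}X(q+s) − Ad_{V̄(q,κ)}(L⁻ᵈ•Σ_s Ad_{V(Γ_{q′,q′+s})}X(q′+s))‖² ≤ 2·L^{1−d}·Σ_sΣ_{t<L}‖∇^{cov}_κX(q+s+te_κ)‖² + 2·L⁻ᵈ·(8((d+1)L)²a + 8w)²·Σ_s‖X(q′+s)‖²`
  — in `d = 3` the gradient slot carries `L⁻²·(multiplicity ≤ L of each κ-bond of the double block) = L⁻¹`, the per-scale gain of ✓II-3 at the top scale.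
NOT HERE: the scale chains (✓F-6c-3a consumes this row as its `P μ` with the normalisation `L^{−2(k−1)}`), the one-scale rows (F-6c-1∕F-6c-2), the oscillations (✓F-6a-2), the sum over corners (F-6d).
HONEST: transport bookkeeping and Cauchy–Schwarz; no estimate of Bałaban's beyond the cited tree∕lit theorems.
References: T. Bałaban, CMP 98 (1985) 17–51 [Balaban1985Averaging] ((42)–(47) pp.23–25, (112) p.34); CMP 95 (1984) 17–40 [Balaban1984PropagatorsI] ((1.18)–(1.20) pp.19–20).
-/

set_option autoImplicit false

noncomputable section

open scoped BigOperators
open Finset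

namespace Summit.QuantumFields.YangMills.Theorems.Prop7CornerCombTopPair

open Literature.MathematicalPhysics.QuantumFieldTheory.Balaban1983to89
open B7Prop1Explicit (Site Letter e hol seg treeWord boxVec disp plaqWord l1 U1 mem_U1 hol_mem hol_append disp_seg disp_treeWord length_seg length_treeWord
  l1_boxVec_le Wcx bavg)
open B7Eq78Linearization (conjR conjR_apply conjR_add conjR_sub conjR_smul_real)
open B7Prop3GeneralRotated (conjR_mul_left norm_conjR_le)
open B7Eq47AveragedBondVsStraight (norm_bavg_sub_straight_le)
open Summit.QuantumFields.YangMills.Theorems.Prop7CornerCombLoopDefects (norm_conjR_hol_sub_conjR_hol_le conjR_hol_append_seg_sub_eq_sum)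

variable {d : ℕ} {𝔸 : Type*} [NormedRing 𝔸] [NormOneClass 𝔸] [NormedAlgebra ℂ 𝔸] [CompleteSpace 𝔸]

/-! ## §1 One small transport letter -/

omit [NormOneClass 𝔸] [NormedAlgebra ℂ 𝔸] [CompleteSpace 𝔸] in
/-- The straight run from the corner followed by the neighbouring block's tree: `V([q,q′] ++ Γ) = V([q,q′])·V(Γ from q′)`, `q′ = q + L•e_κ` (lit ✓`hol_append`, ✓`disp_seg`).
[folklore] [cite: Balaban1985Averaging, (9) p.18] -/
theorem hol_seg_append (V : Site d → Fin d → 𝔸ˣ) (q : Site d) (κ : Fin d) (L : ℕ) (w : List (Letter d)) :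
    hol V q (seg κ (L : ℤ) ++ w) = hol V q (seg κ (L : ℤ)) * hol V (q + (L : ℤ) • e κ) w := by
  rw [hol_append, disp_seg, natCast_zsmul]

/-! ## §2 The per-site row: exact telescoping along the straight run + two re-basing defects -/

/-- ★ **THE PER-SITE TOP-PAIR ROW**: `V` valued in `U1` with every plaquette holonomy within `a ≥ 0` of `1` and the loop variables of the averaged bond `⟨q, q + L•e_κ⟩` within `w ≤ 1∕8`
of `1`, `V̄(q,κ)` itself in `U1` (unitary backgrounds: lit ✓`bavg_mem_unitaryUnits`); block offset `s`, `x = q + s`, `x′ = q′ + s`, `q′ = q + L•e_κ`.  Then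
`‖Ad_{V(Γ_{q,x})}X(x) − Ad_{V̄(q,κ)}Ad_{V(Γ_{q′,x′})}X(x′)‖ ≤ Σ_{t<L} ‖Ad_{V(x+te_κ,κ)}X(x+(t+1)e_κ) − X(x+te_κ)‖ + (8((d+1)L)²·a + 8w)·‖X(x′)‖`
— (I) exact telescoping (✓`conjR_hol_append_seg_sub_eq_sum`), (II) re-basing `Γ_{q,x} ++ [x,x′]` to `[q,q′] ++ Γ_{q′,x′}` (✓`norm_conjR_hol_sub_conjR_hol_le`, loop length `≤ 2(d+1)L`),
(III) `V̄(q,κ)` against `V([q,q′])` (lit ✓`norm_bavg_sub_straight_le`). [cite: Balaban1985Averaging, (42)-(47) pp.23-25, (112) p.34; Balaban1984PropagatorsI, (1.18)-(1.20) pp.19-20] -/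
theorem norm_transport_pair_sub_le (L : ℕ) [NeZero L] (V : Site d → Fin d → 𝔸ˣ) (hV : ∀ x κ, V x κ ∈ U1 𝔸) {a : ℝ} (ha : 0 ≤ a)
    (hplaq : ∀ (x : Site d) (κ μ : Fin d), κ ≠ μ → ‖((hol V x (plaqWord κ μ) : 𝔸ˣ) : 𝔸) - 1‖ ≤ a)
    (q : Site d) (κ : Fin d) {w : ℝ} (hw : ∀ r : Fin d → Fin L, ‖((Wcx L V q κ (boxVec L r) : 𝔸ˣ) : 𝔸) - 1‖ ≤ w) (hw8 : w ≤ 1 / 8)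
    (hbU : bavg L V q κ ∈ U1 𝔸) (X : Site d → 𝔸) (s : Fin d → Fin L) :
    ‖conjR (hol V q (treeWord (boxVec L s))) (X (q + boxVec L s))
        - conjR (bavg L V q κ) (conjR (hol V (q + (L : ℤ) • e κ) (treeWord (boxVec L s))) (X (q + (L : ℤ) • e κ + boxVec L s)))‖
      ≤ (∑ t ∈ range L, ‖conjR (V (q + boxVec L s + (t : ℤ) • e κ) κ) (X (q + boxVec L s + (t : ℤ) • e κ + e κ)) - X (q + boxVec L s + (t : ℤ) • e κ)‖)
        + (8 * (((d : ℝ) + 1) * (L : ℝ)) ^ 2 * a + 8 * w) * ‖X (q + (L : ℤ) • e κ + boxVec L s)‖ := by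
  -- names
  set p : List (Letter d) := treeWord (boxVec L s) with hp
  set x : Site d := q + boxVec L s with hx
  set q' : Site d := q + (L : ℤ) • e κ with hq'
  set x' : Site d := q + (L : ℤ) • e κ + boxVec L s with hx'
  have hx'x : x' = x + (L : ℤ) • e κ := by rw [hx', hx, add_right_comm]
  have hdp : disp p = boxVec L s := by rw [hp, disp_treeWord]
  set T1 : 𝔸 := conjR (hol V q p) (X x) with hT1
  set T2 : 𝔸 := conjR (hol V q (p ++ seg κ (L : ℤ))) (X x') with hT2
  set T3 : 𝔸 := conjR (hol V q (seg κ (L : ℤ) ++ p)) (X x') with hT3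
  set T4 : 𝔸 := conjR (bavg L V q κ) (conjR (hol V q' p) (X x')) with hT4
  -- (I) exact telescoping along the straight run
  have hI : ‖T1 - T2‖ ≤ ∑ t ∈ range L, ‖conjR (V (x + (t : ℤ) • e κ) κ) (X (x + (t : ℤ) • e κ + e κ)) - X (x + (t : ℤ) • e κ)‖ := by
    have htel := conjR_hol_append_seg_sub_eq_sum V q p κ X L
    rw [hdp, ← hx, ← hx'x] at htel
    rw [norm_sub_rev, hT2, hT1, htel]
    refine (norm_sum_le _ _).trans (Finset.sum_le_sum fun t _ => ?_)
    exact norm_conjR_le (hol_mem hV _ _) _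
  -- (II) re-basing the transport: a closed loop of length ≤ 2(d+1)L
  have hII : ‖T2 - T3‖ ≤ 8 * (((d : ℝ) + 1) * (L : ℝ)) ^ 2 * a * ‖X x'‖ := by
    have hdisp : disp (p ++ seg κ (L : ℤ)) = disp (seg κ (L : ℤ) ++ p) := by
      rw [B7Prop1Explicit.disp_append, B7Prop1Explicit.disp_append, add_comm]
    have h := norm_conjR_hol_sub_conjR_hol_le V hV ha hplaq q (p ++ seg κ (L : ℤ)) (seg κ (L : ℤ) ++ p) hdisp (X x')
    have hlen : ((p ++ seg κ (L : ℤ)).length + (seg κ (L : ℤ) ++ p).length : ℕ) = 2 * (l1 (boxVec L s) + L) := by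
      simp only [List.length_append, hp, length_treeWord, length_seg, Int.natAbs_natCast]; ring
    rw [hlen] at h
    refine h.trans ?_
    have hl1 : ((l1 (boxVec L s) : ℕ) : ℝ) ≤ (d : ℝ) * (L : ℝ) := by exact_mod_cast l1_boxVec_le L s
    have hn : (((2 * (l1 (boxVec L s) + L) : ℕ)) : ℝ) ≤ 2 * (((d : ℝ) + 1) * (L : ℝ)) := by push_cast; nlinarith
    have hn0 : (0 : ℝ) ≤ (((2 * (l1 (boxVec L s) + L) : ℕ)) : ℝ) := Nat.cast_nonneg _
    have hX0 : 0 ≤ ‖X x'‖ := norm_nonneg _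
    calc 2 * ((((2 * (l1 (boxVec L s) + L) : ℕ)) : ℝ) * ((((2 * (l1 (boxVec L s) + L) : ℕ)) : ℝ) * a)) * ‖X x'‖
        ≤ 2 * ((2 * (((d : ℝ) + 1) * (L : ℝ))) * ((2 * (((d : ℝ) + 1) * (L : ℝ))) * a)) * ‖X x'‖ := by gcongr
      _ = 8 * (((d : ℝ) + 1) * (L : ℝ)) ^ 2 * a * ‖X x'‖ := by ring
  -- (III) the averaged bond against the straight transporter
  have hIII : ‖T3 - T4‖ ≤ 8 * w * ‖X x'‖ := by
    have h3 : T3 = conjR (hol V q (seg κ (L : ℤ))) (conjR (hol V q' p) (X x')) := by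
      rw [hT3, hol_seg_append, conjR_mul_left]
    rw [h3, hT4]
    have hb := norm_bavg_sub_straight_le L hV q κ hw hw8
    have hw0 : 0 ≤ w := (norm_nonneg _).trans (hw fun _ => 0)
    -- conjugation is `2`-Lipschitz in the unit on `U1` (the content of ★w4-20520 g12's ✓`Prop7CornerFrameLegsLetters.norm_conjR_sub_conjR_le`, kept as a local step here to keep
    -- this file's import closure inside the (II) lane): `Ad_u y − Ad_v y = Ad_v (Ad_{v⁻¹u} y − y)`, `‖v⁻¹u − 1‖ ≤ ‖u − v‖`
    have norm_conjR_sub_conjR_le : ∀ {u v : 𝔸ˣ}, u ∈ U1 𝔸 → v ∈ U1 𝔸 → ∀ y : 𝔸, ‖conjR u y - conjR v y‖ ≤ 2 * ‖(u : 𝔸) - (v : 𝔸)‖ * ‖y‖ := by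
      intro u v hu hv y
      have hfac : conjR u y - conjR v y = conjR v (conjR (v⁻¹ * u) y - y) := by
        rw [conjR_sub, ← conjR_mul_left, mul_inv_cancel_left]
      have hvu : v⁻¹ * u ∈ U1 𝔸 := Subgroup.mul_mem _ (Subgroup.inv_mem _ hv) hu
      have hdist : ‖(((v⁻¹ * u : 𝔸ˣ)) : 𝔸) - 1‖ ≤ ‖(u : 𝔸) - (v : 𝔸)‖ := by
        have e1 : (((v⁻¹ * u : 𝔸ˣ)) : 𝔸) - 1 = ((v⁻¹ : 𝔸ˣ) : 𝔸) * ((u : 𝔸) - (v : 𝔸)) := by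
          rw [mul_sub, Units.val_mul, Units.inv_mul]
        rw [e1]
        calc ‖((v⁻¹ : 𝔸ˣ) : 𝔸) * ((u : 𝔸) - (v : 𝔸))‖ ≤ ‖((v⁻¹ : 𝔸ˣ) : 𝔸)‖ * ‖(u : 𝔸) - (v : 𝔸)‖ := norm_mul_le _ _
          _ ≤ 1 * ‖(u : 𝔸) - (v : 𝔸)‖ := mul_le_mul_of_nonneg_right (mem_U1.1 hv).2 (norm_nonneg _)
          _ = _ := one_mul _
      rw [hfac]
      calc ‖conjR v (conjR (v⁻¹ * u) y - y)‖ ≤ ‖conjR (v⁻¹ * u) y - y‖ := norm_conjR_le hv _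
        _ ≤ 2 * ‖(((v⁻¹ * u : 𝔸ˣ)) : 𝔸) - 1‖ * ‖y‖ := by
            rw [conjR_apply]
            exact B8CurlGradHolonomy.norm_conj_sub_le _ _ (mem_U1.1 hvu).2
        _ ≤ 2 * ‖(u : 𝔸) - (v : 𝔸)‖ * ‖y‖ := by gcongr
    calc ‖conjR (hol V q (seg κ (L : ℤ))) (conjR (hol V q' p) (X x')) - conjR (bavg L V q κ) (conjR (hol V q' p) (X x'))‖
        ≤ 2 * ‖((hol V q (seg κ (L : ℤ)) : 𝔸ˣ) : 𝔸) - ((bavg L V q κ : 𝔸ˣ) : 𝔸)‖ * ‖conjR (hol V q' p) (X x')‖ :=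
          norm_conjR_sub_conjR_le (hol_mem hV _ _) hbU _
      _ ≤ 2 * (4 * w) * ‖X x'‖ := by
          rw [norm_sub_rev]
          exact mul_le_mul (mul_le_mul_of_nonneg_left hb zero_le_two) (norm_conjR_le (hol_mem hV _ _) _) (norm_nonneg _)
            (by positivity)
      _ = 8 * w * ‖X x'‖ := by ring
  -- assemble
  calc ‖T1 - T4‖ = ‖(T1 - T2) + (T2 - T3) + (T3 - T4)‖ := by congr 1; abel
    _ ≤ ‖T1 - T2‖ + ‖T2 - T3‖ + ‖T3 - T4‖ := (norm_add_le _ _).trans (add_le_add (norm_add_le _ _) le_rfl)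
    _ ≤ (∑ t ∈ range L, ‖conjR (V (x + (t : ℤ) • e κ) κ) (X (x + (t : ℤ) • e κ + e κ)) - X (x + (t : ℤ) • e κ)‖)
          + 8 * (((d : ℝ) + 1) * (L : ℝ)) ^ 2 * a * ‖X x'‖ + 8 * w * ‖X x'‖ := add_le_add (add_le_add hI hII) hIII
    _ = _ := by ring

/-! ## §3 The top-pair row for the block means -/

/-- ★★ **THE TOP-PAIR ROW** (PENS ROUND 3 (iv), organisation β): under the hypotheses of `norm_transport_pair_sub_le`, the comb-transported block mean of `X` over `B(q) = q + [0,L)ᵈ` and the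
`V̄(q,κ)`-transported block mean over the NEIGHBOURING block `B(q + L•e_κ)` satisfy
`‖L⁻ᵈ•Σ_s Ad_{V(Γ_{q,q+s})}X(q+s) − Ad_{V̄(q,κ)}(L⁻ᵈ•Σ_s Ad_{V(Γ_{q′,q′+s})}X(q′+s))‖² ≤ 2·L⁻ᵈ·L·Σ_sΣ_{t<L}‖Ad_{V(q+s+te_κ,κ)}X(q+s+(t+1)e_κ) − X(q+s+te_κ)‖² + 2·L⁻ᵈ·(8((d+1)L)²a + 8w)²·Σ_s‖X(q′+s)‖²`
— Cauchy–Schwarz over the `Lᵈ` offsets and the `L` steps of each run; the double sum visits each `κ`-bond of the double block at most `L` times, so in `d = 3` the gradient slot is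
`L⁻²·L·GRAD^{cov}_κ(B ∪ B′) = L⁻¹·GRAD` — the top-scale gain of ✓II-3.  Consumed by ✓F-6c-3a `normSq_covGrad_le_of_rows` as its `P μ` (with `X := G_{k−1}(·, μ)`, `V := Ū₀^{k−1}`, `q := L•z`,
`V̄(q,κ) = Ū₀ᵏ(z,κ)` by lit `avgIter_succ`, and the normalisation `L^{−2(k−1)}`). [cite: Balaban1985Averaging, (42)-(47) pp.23-25, (112) p.34; Balaban1984PropagatorsI, (1.18)-(1.20) pp.19-20] -/
theorem normSq_blockMean_sub_conjR_bavg_blockMean_le (L : ℕ) [NeZero L] (V : Site d → Fin d → 𝔸ˣ) (hV : ∀ x κ, V x κ ∈ U1 𝔸) {a : ℝ} (ha : 0 ≤ a)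
    (hplaq : ∀ (x : Site d) (κ μ : Fin d), κ ≠ μ → ‖((hol V x (plaqWord κ μ) : 𝔸ˣ) : 𝔸) - 1‖ ≤ a)
    (q : Site d) (κ : Fin d) {w : ℝ} (hw : ∀ r : Fin d → Fin L, ‖((Wcx L V q κ (boxVec L r) : 𝔸ˣ) : 𝔸) - 1‖ ≤ w) (hw8 : w ≤ 1 / 8)
    (hbU : bavg L V q κ ∈ U1 𝔸) (X : Site d → 𝔸) :
    ‖(((L : ℝ) ^ d)⁻¹ • ∑ s : Fin d → Fin L, conjR (hol V q (treeWord (boxVec L s))) (X (q + boxVec L s)))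
        - conjR (bavg L V q κ) ((((L : ℝ) ^ d)⁻¹ • ∑ s : Fin d → Fin L,
            conjR (hol V (q + (L : ℤ) • e κ) (treeWord (boxVec L s))) (X (q + (L : ℤ) • e κ + boxVec L s))))‖ ^ 2
      ≤ 2 * ((L : ℝ) ^ d)⁻¹ * (L : ℝ) * ∑ s : Fin d → Fin L, ∑ t ∈ range L,
            ‖conjR (V (q + boxVec L s + (t : ℤ) • e κ) κ) (X (q + boxVec L s + (t : ℤ) • e κ + e κ)) - X (q + boxVec L s + (t : ℤ) • e κ)‖ ^ 2
        + 2 * ((L : ℝ) ^ d)⁻¹ * (8 * (((d : ℝ) + 1) * (L : ℝ)) ^ 2 * a + 8 * w) ^ 2 * ∑ s : Fin d → Fin L, ‖X (q + (L : ℤ) • e κ + boxVec L s)‖ ^ 2 := by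
  have hL0 : (0 : ℝ) < (L : ℝ) := by exact_mod_cast Nat.pos_of_ne_zero (NeZero.ne L)
  -- names
  set c : ℝ := ((L : ℝ) ^ d)⁻¹ with hc
  have hc0 : 0 ≤ c := by rw [hc]; positivity
  set u : 𝔸ˣ := bavg L V q κ with hu
  set T1 : (Fin d → Fin L) → 𝔸 := fun s => conjR (hol V q (treeWord (boxVec L s))) (X (q + boxVec L s)) with hT1
  set T' : (Fin d → Fin L) → 𝔸 := fun s => conjR (hol V (q + (L : ℤ) • e κ) (treeWord (boxVec L s))) (X (q + (L : ℤ) • e κ + boxVec L s)) with hT'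
  set g : (Fin d → Fin L) → ℕ → ℝ := fun s t =>
    ‖conjR (V (q + boxVec L s + (t : ℤ) • e κ) κ) (X (q + boxVec L s + (t : ℤ) • e κ + e κ)) - X (q + boxVec L s + (t : ℤ) • e κ)‖ with hg
  set A : (Fin d → Fin L) → ℝ := fun s => ∑ t ∈ range L, g s t with hA
  set B : (Fin d → Fin L) → ℝ := fun s => ‖X (q + (L : ℤ) • e κ + boxVec L s)‖ with hB
  set c₀ : ℝ := 8 * (((d : ℝ) + 1) * (L : ℝ)) ^ 2 * a + 8 * w with hc₀
  have hw0 : 0 ≤ w := (norm_nonneg _).trans (hw fun _ => 0)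
  have hc₀0 : 0 ≤ c₀ := by rw [hc₀]; positivity
  have hcard : ((Finset.univ : Finset (Fin d → Fin L)).card : ℝ) = (L : ℝ) ^ d := by
    rw [Finset.card_univ, Fintype.card_fun, Fintype.card_fin, Fintype.card_fin]; push_cast; ring
  -- the difference is `c • Σ_s (T1 s − Ad_u T' s)`
  have hD : (c • ∑ s, T1 s) - conjR u (c • ∑ s, T' s) = c • ∑ s, (T1 s - conjR u (T' s)) := by
    have hsum : conjR u (∑ s, T' s) = ∑ s, conjR u (T' s) := map_sum (AddMonoidHom.mk' (conjR u) (conjR_add u)) _ _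
    rw [conjR_smul_real, hsum, ← smul_sub, ← Finset.sum_sub_distrib]
  -- per-site rows (§2)
  have hsite : ∀ s, ‖T1 s - conjR u (T' s)‖ ≤ A s + c₀ * B s := fun s =>
    norm_transport_pair_sub_le L V hV ha hplaq q κ hw hw8 hbU X s
  -- the norm
  have hN : ‖(c • ∑ s, T1 s) - conjR u (c • ∑ s, T' s)‖ ≤ c * (∑ s, A s + ∑ s, c₀ * B s) := by
    rw [hD, norm_smul, Real.norm_of_nonneg hc0, ← Finset.sum_add_distrib]
    exact mul_le_mul_of_nonneg_left ((norm_sum_le _ _).trans (Finset.sum_le_sum fun s _ => hsite s)) hc0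
  -- Cauchy–Schwarz over offsets and steps
  have hA2 : (∑ s, A s) ^ 2 ≤ (L : ℝ) ^ d * ((L : ℝ) * ∑ s, ∑ t ∈ range L, g s t ^ 2) := by
    have h1 : (∑ s, A s) ^ 2 ≤ ((Finset.univ : Finset (Fin d → Fin L)).card : ℝ) * ∑ s, A s ^ 2 := sq_sum_le_card_mul_sum_sq
    rw [hcard] at h1
    refine h1.trans (mul_le_mul_of_nonneg_left ?_ (by positivity))
    rw [Finset.mul_sum]
    refine Finset.sum_le_sum fun s _ => ?_
    have h2 : (∑ t ∈ range L, g s t) ^ 2 ≤ ((range L).card : ℝ) * ∑ t ∈ range L, g s t ^ 2 := sq_sum_le_card_mul_sum_sq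
    rw [Finset.card_range] at h2
    exact h2
  have hB2 : (∑ s, c₀ * B s) ^ 2 ≤ (L : ℝ) ^ d * (c₀ ^ 2 * ∑ s, B s ^ 2) := by
    have h1 : (∑ s, c₀ * B s) ^ 2 ≤ ((Finset.univ : Finset (Fin d → Fin L)).card : ℝ) * ∑ s, (c₀ * B s) ^ 2 := sq_sum_le_card_mul_sum_sq
    rw [hcard] at h1
    refine h1.trans (le_of_eq ?_)
    rw [Finset.mul_sum, Finset.mul_sum, Finset.mul_sum]
    exact Finset.sum_congr rfl fun s _ => by ring
  have hsq : ∀ x y : ℝ, (x + y) ^ 2 ≤ 2 * x ^ 2 + 2 * y ^ 2 := fun x y => by nlinarith [sq_nonneg (x - y)]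
  have hN0 : 0 ≤ ‖(c • ∑ s, T1 s) - conjR u (c • ∑ s, T' s)‖ := norm_nonneg _
  have hcL : c * (L : ℝ) ^ d = 1 := by rw [hc]; exact inv_mul_cancel₀ (by positivity)
  calc ‖(c • ∑ s, T1 s) - conjR u (c • ∑ s, T' s)‖ ^ 2
      ≤ (c * (∑ s, A s + ∑ s, c₀ * B s)) ^ 2 := pow_le_pow_left₀ hN0 hN 2
    _ = c ^ 2 * (∑ s, A s + ∑ s, c₀ * B s) ^ 2 := by ring
    _ ≤ c ^ 2 * (2 * (∑ s, A s) ^ 2 + 2 * (∑ s, c₀ * B s) ^ 2) := mul_le_mul_of_nonneg_left (hsq _ _) (sq_nonneg _)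
    _ ≤ c ^ 2 * (2 * ((L : ℝ) ^ d * ((L : ℝ) * ∑ s, ∑ t ∈ range L, g s t ^ 2)) + 2 * ((L : ℝ) ^ d * (c₀ ^ 2 * ∑ s, B s ^ 2))) := by
        gcongr
    _ = (c * (L : ℝ) ^ d) * (2 * c * (L : ℝ) * ∑ s, ∑ t ∈ range L, g s t ^ 2 + 2 * c * c₀ ^ 2 * ∑ s, B s ^ 2) := by ring
    _ = 2 * c * (L : ℝ) * ∑ s, ∑ t ∈ range L, g s t ^ 2 + 2 * c * c₀ ^ 2 * ∑ s, B s ^ 2 := by rw [hcL, one_mul]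

end Summit.QuantumFields.YangMills.Theorems.Prop7CornerCombTopPair

end
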